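import Summits.NavierStokesRegularity.FunctionalMining.TopEigWeightedBalance
import HarnessLib

/-!
# FunctionalMining — the viscous term of a SQUARED convex weight controls a gradient

Search for candidate a priori estimates; no regularity claim. Cell `pub-nsfunc`, prove seat
(gen 17). The "convexity gain" of SIEVELD §3.4 (b) (Theorem G (ii), nogo N14), in the kernel and
for an arbitrary Euclidean-valued smooth field `Θ : T^d → E`:

**`ConvexWeight.integral_mul_fderiv_laplacian_le`.** If `ψ` is `C²` on an open `U ⊇ Θ(T^d)` with
positive semidefinite second derivative at the values of `Θ` and `ψ ∘ Θ ≥ 0`, then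

`∫ ψ(Θ) · Dψ(Θ)[ΔΘ] ≤ −∫ ∑ₖ (∂ₖ(ψ ∘ Θ))²`.

Proof: with `f = ψ ∘ Θ` and `φₖ = Dψ(Θ)[∂ₖΘ] = ∂ₖf`, the tree's Leibniz identity
`∂ₖφₖ = D²ψ(Θ)[∂ₖΘ,∂ₖΘ] + Dψ(Θ)[∂ₖ∂ₖΘ]` (`ConvexWeight.partialDeriv_fderiv_apply_partialDeriv`) and
`∫ ∂ₖ(f φₖ) = 0` give `∫ f·Dψ(Θ)[∂ₖ∂ₖΘ] = −∫ φₖ² − ∫ f·D²ψ(Θ)[∂ₖΘ,∂ₖΘ] ≤ −∫ (∂ₖf)²`.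
Consequence for the weight `W = ψ²` (`DW = 2ψ Dψ`): `∫ DW(Θ)[ΔΘ] ≤ −2 ∫ |∇(ψ∘Θ)|²`
(`ConvexWeight.integral_fderiv_sq_laplacian_le`) — the dissipation of `∫ W(S)` controls
`‖∇ W(S)^{1/2}‖₂²`, as for `|ω|^q`, `|S|^q` (where it is Kato / the explicit chain rule). [ours; folklore
calculus]
-/

noncomputable section

open MeasureTheory Set Filter Topology Finset
open scoped ContDiff

namespace Summit.NavierStokesRegularity.FunctionalMining

open Literature.Analysis.FunctionSpaces Literature.Analysis.FunctionSpaces.Torus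

namespace ConvexWeight

variable {d : Type*} [Fintype d] [DecidableEq d]
variable {E : Type*} [NormedAddCommGroup E] [NormedSpace ℝ E]

omit [DecidableEq d] in
/-- `ψ ∘ Θ` is of class `C¹` for `ψ` of class `C¹` on an open set containing the range of the smooth
field `Θ`. [folklore] -/
theorem isContDiff_one_comp {U : Set E} {ψ : E → ℝ} (hψ : ContDiffOn ℝ 1 ψ U)
    {Θ : UnitAddTorus d → E} (hΘ : IsSmooth Θ) (hmaps : ∀ y, Θ y ∈ U) :
    IsContDiff 1 (fun y => ψ (Θ y)) := by
  unfold IsContDiff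
  exact hψ.comp_contDiff (hΘ.isContDiff (by simp)) fun x => hmaps _

/-- `∂ₖ(ψ ∘ Θ) = Dψ(Θ)[∂ₖΘ]` (chain rule on the torus, `ψ` of class `C¹` on an open `U ⊇ Θ(T^d)`).
[folklore] -/
theorem partialDeriv_comp_eq {U : Set E} (hU : IsOpen U) {ψ : E → ℝ} (hψ : ContDiffOn ℝ 1 ψ U)
    {Θ : UnitAddTorus d → E} (hΘ : IsSmooth Θ) (hmaps : ∀ y, Θ y ∈ U) (k : d) (y : UnitAddTorus d) :
    partialDeriv k (fun z => ψ (Θ z)) y = fderiv ℝ ψ (Θ y) (partialDeriv k Θ y) :=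
  TopEig.partialDeriv_comp_eq_fderiv (hΘ.isContDiff (by simp)) y
    ((hψ.differentiableOn (by simp)).differentiableAt (hU.mem_nhds (hmaps y))) k

/-- **One direction, with the gradient kept**:
`∫ ψ(Θ)·Dψ(Θ)[∂ₖ∂ₖΘ] = −∫ (∂ₖ(ψ∘Θ))² − ∫ ψ(Θ)·D²ψ(Θ)[∂ₖΘ,∂ₖΘ]`. [folklore] -/
theorem integral_mul_fderiv_partialDeriv_partialDeriv_eq {U : Set E} (hU : IsOpen U) {ψ : E → ℝ}
    (hψ : ContDiffOn ℝ 2 ψ U) {Θ : UnitAddTorus d → E} (hΘ : IsSmooth Θ) (hmaps : ∀ y, Θ y ∈ U)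
    (k : d) :
    ∫ y, ψ (Θ y) * fderiv ℝ ψ (Θ y) (partialDeriv k (partialDeriv k Θ) y) =
      -(∫ y, (partialDeriv k (fun z => ψ (Θ z)) y) ^ 2) -
        ∫ y, ψ (Θ y) * (fderiv ℝ (fderiv ℝ ψ) (Θ y) (partialDeriv k Θ y)) (partialDeriv k Θ y) := by
  have hψ1 : ContDiffOn ℝ 1 ψ U := hψ.of_le (by norm_num)
  -- the two `C¹` factors `f = ψ ∘ Θ` and `φₖ = Dψ(Θ)[∂ₖΘ]`
  set f : UnitAddTorus d → ℝ := fun z => ψ (Θ z) with hf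
  set φ : UnitAddTorus d → ℝ := fun z => fderiv ℝ ψ (Θ z) (partialDeriv k Θ z) with hφ
  have hf1 : IsContDiff 1 f := isContDiff_one_comp hψ1 hΘ hmaps
  have hφ1 : IsContDiff 1 φ := isContDiff_one_fderiv_apply_partialDeriv hU hψ hΘ hmaps k
  have hfk : ∀ y, partialDeriv k f y = φ y := fun y => partialDeriv_comp_eq hU hψ1 hΘ hmaps k y
  have hφk : ∀ y, partialDeriv k φ y =
      (fderiv ℝ (fderiv ℝ ψ) (Θ y) (partialDeriv k Θ y)) (partialDeriv k Θ y) +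
        fderiv ℝ ψ (Θ y) (partialDeriv k (partialDeriv k Θ) y) := fun y =>
    partialDeriv_fderiv_apply_partialDeriv hU hψ hΘ hmaps k y
  -- `∫ ∂ₖ(f φ) = 0` and Leibniz
  have hzero := Torus.integral_partialDeriv_eq_zero_of_isContDiff
    (show IsContDiff 1 (fun y => f y * φ y) by
      unfold IsContDiff at hf1 hφ1 ⊢; exact hf1.mul hφ1) k
  have hleib : ∀ y, partialDeriv k (fun y => f y * φ y) y =
      φ y ^ 2 + (f y * (fderiv ℝ (fderiv ℝ ψ) (Θ y) (partialDeriv k Θ y)) (partialDeriv k Θ y) +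
        f y * fderiv ℝ ψ (Θ y) (partialDeriv k (partialDeriv k Θ) y)) := by
    intro y
    rw [Torus.partialDeriv_mul hf1 hφ1 k y, hφk y, hfk y]
    ring
  simp_rw [hleib] at hzero
  -- continuity (integrability) of the three pieces
  have hfc : Continuous f := hf1.continuous
  have hφc : Continuous φ := hφ1.continuous
  have hi1 : Integrable (fun y => φ y ^ 2) := (hφc.pow 2).integrable_unitAddTorus
  have hi2 : Integrable (fun y =>
      f y * (fderiv ℝ (fderiv ℝ ψ) (Θ y) (partialDeriv k Θ y)) (partialDeriv k Θ y)) :=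
    (hfc.mul (continuous_hessian_apply hU hψ hΘ hmaps k)).integrable_unitAddTorus
  have hi3 : Integrable (fun y => f y * fderiv ℝ ψ (Θ y) (partialDeriv k (partialDeriv k Θ) y)) :=
    (hfc.mul (continuous_fderiv_apply hU hψ hΘ hmaps
      ((hΘ.partialDeriv k).partialDeriv k).continuous)).integrable_unitAddTorus
  have hi23 : Integrable (fun y =>
      f y * (fderiv ℝ (fderiv ℝ ψ) (Θ y) (partialDeriv k Θ y)) (partialDeriv k Θ y) +
        f y * fderiv ℝ ψ (Θ y) (partialDeriv k (partialDeriv k Θ) y)) := hi2.add hi3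
  rw [integral_add hi1 hi23, integral_add hi2 hi3] at hzero
  have hsq : ∫ y, (partialDeriv k f y) ^ 2 = ∫ y, φ y ^ 2 :=
    integral_congr_ae (ae_of_all _ fun y => by simp only [hfk y])
  rw [hsq]
  linarith

/-- **The viscous term of `∫ ψ(Θ)²/1` controls the gradient of `ψ ∘ Θ`:** for `ψ` of class `C²`
on an open `U ⊇ Θ(T^d)` with `D²ψ(Θ y)[w,w] ≥ 0` and `ψ(Θ y) ≥ 0`,
`∫ ψ(Θ)·Dψ(Θ)[ΔΘ] ≤ −∫ ∑ₖ (∂ₖ(ψ∘Θ))²`. [ours; folklore calculus] -/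
theorem integral_mul_fderiv_laplacian_le {U : Set E} (hU : IsOpen U) {ψ : E → ℝ}
    (hψ : ContDiffOn ℝ 2 ψ U) {Θ : UnitAddTorus d → E} (hΘ : IsSmooth Θ) (hmaps : ∀ y, Θ y ∈ U)
    (hpsd : ∀ y (w : E), 0 ≤ (fderiv ℝ (fderiv ℝ ψ) (Θ y) w) w) (hψ0 : ∀ y, 0 ≤ ψ (Θ y)) :
    ∫ y, ψ (Θ y) * fderiv ℝ ψ (Θ y) (Torus.laplacian Θ y) ≤
      -∫ y, ∑ k, (partialDeriv k (fun z => ψ (Θ z)) y) ^ 2 := by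
  have hψ1 : ContDiffOn ℝ 1 ψ U := hψ.of_le (by norm_num)
  have hf1 : IsContDiff 1 (fun z => ψ (Θ z)) := isContDiff_one_comp hψ1 hΘ hmaps
  have hfc : Continuous (fun z => ψ (Θ z)) := hf1.continuous
  have hlap : ∀ y, ψ (Θ y) * fderiv ℝ ψ (Θ y) (Torus.laplacian Θ y) =
      ∑ k, ψ (Θ y) * fderiv ℝ ψ (Θ y) (partialDeriv k (partialDeriv k Θ) y) := fun y => by
    rw [Torus.laplacian_eq_sum_partialDeriv_partialDeriv hΘ y, map_sum, Finset.mul_sum]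
  simp_rw [hlap]
  have hik : ∀ k, Integrable (fun y =>
      ψ (Θ y) * fderiv ℝ ψ (Θ y) (partialDeriv k (partialDeriv k Θ) y)) := fun k =>
    (hfc.mul (continuous_fderiv_apply hU hψ hΘ hmaps
      ((hΘ.partialDeriv k).partialDeriv k).continuous)).integrable_unitAddTorus
  have hik' : ∀ k, Integrable (fun y => (partialDeriv k (fun z => ψ (Θ z)) y) ^ 2) := by
    intro k
    have e : (fun y => (partialDeriv k (fun z => ψ (Θ z)) y) ^ 2) =
        fun y => (fderiv ℝ ψ (Θ y) (partialDeriv k Θ y)) ^ 2 :=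
      funext fun y => by rw [partialDeriv_comp_eq hU hψ1 hΘ hmaps k y]
    rw [e]
    exact ((continuous_fderiv_apply hU hψ hΘ hmaps
      (hΘ.partialDeriv k).continuous).pow 2).integrable_unitAddTorus
  rw [integral_finsetSum _ fun k _ => hik k, integral_finsetSum _ fun k _ => hik' k,
    ← Finset.sum_neg_distrib]
  refine Finset.sum_le_sum fun k _ => ?_
  rw [integral_mul_fderiv_partialDeriv_partialDeriv_eq hU hψ hΘ hmaps k]
  have hnn : 0 ≤ ∫ y, ψ (Θ y) *
      (fderiv ℝ (fderiv ℝ ψ) (Θ y) (partialDeriv k Θ y)) (partialDeriv k Θ y) :=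
    integral_nonneg fun y => mul_nonneg (hψ0 y) (hpsd y _)
  linarith

/-- The derivative of `W = ψ²` at a point of `U`: `DW(z)[w] = 2 ψ(z) Dψ(z)[w]`, for any `W` that
agrees with `ψ²` on the open set `U`. [folklore] -/
theorem fderiv_sq_apply {U : Set E} (hU : IsOpen U) {ψ W : E → ℝ} (hψ : ContDiffOn ℝ 1 ψ U)
    (hW : ∀ z ∈ U, W z = ψ z ^ 2) {z : E} (hz : z ∈ U) (w : E) :
    fderiv ℝ W z w = 2 * ψ z * fderiv ℝ ψ z w := by
  have hd : DifferentiableAt ℝ ψ z :=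
    (hψ.differentiableOn (by simp)).differentiableAt (hU.mem_nhds hz)
  have h1 : HasFDerivAt (fun x => ψ x ^ 2) ((2 * ψ z) • fderiv ℝ ψ z) z := by
    have h := hd.hasFDerivAt.pow 2
    simpa [pow_one] using h
  have heq : W =ᶠ[𝓝 z] fun x => ψ x ^ 2 := by
    filter_upwards [hU.mem_nhds hz] with x hx using hW x hx
  rw [heq.fderiv_eq, h1.fderiv]
  simp [smul_eq_mul]

/-- **Squared convex weights**: if `W = ψ²` on an open `U ⊇ Θ(T^d)`, `ψ` of class `C²` on `U` with
positive semidefinite second derivative at the values of `Θ` and `ψ(Θ) ≥ 0`, then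
`∫ DW(Θ)[ΔΘ] ≤ −2 ∫ ∑ₖ (∂ₖ(ψ∘Θ))²`. [ours; SIEVELD §3.4 (b) "convexity gain", generic form] -/
theorem integral_fderiv_sq_laplacian_le {U : Set E} (hU : IsOpen U) {ψ W : E → ℝ}
    (hψ : ContDiffOn ℝ 2 ψ U) (hW : ∀ z ∈ U, W z = ψ z ^ 2) {Θ : UnitAddTorus d → E}
    (hΘ : IsSmooth Θ) (hmaps : ∀ y, Θ y ∈ U)
    (hpsd : ∀ y (w : E), 0 ≤ (fderiv ℝ (fderiv ℝ ψ) (Θ y) w) w) (hψ0 : ∀ y, 0 ≤ ψ (Θ y)) :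
    ∫ y, fderiv ℝ W (Θ y) (Torus.laplacian Θ y) ≤
      -2 * ∫ y, ∑ k, (partialDeriv k (fun z => ψ (Θ z)) y) ^ 2 := by
  have hψ1 : ContDiffOn ℝ 1 ψ U := hψ.of_le (by norm_num)
  have heq : ∀ y, fderiv ℝ W (Θ y) (Torus.laplacian Θ y) =
      2 * (ψ (Θ y) * fderiv ℝ ψ (Θ y) (Torus.laplacian Θ y)) := fun y => by
    rw [fderiv_sq_apply hU hψ1 hW (hmaps y), mul_assoc]
  simp_rw [heq]
  rw [integral_const_mul]
  have h := integral_mul_fderiv_laplacian_le hU hψ hΘ hmaps hpsd hψ0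
  linarith

end ConvexWeight

end Summit.NavierStokesRegularity.FunctionalMining

end
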